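import Summits.NavierStokesRegularity.OSWSelfSimilar.SheetRTimeShiftMode
import Mathlib.MeasureTheory.Integral.IntervalIntegral.FundThmCalculus
import HarnessLib

/-!
# SHEET-ℝ: the TRANSLATION mode — `σ = ½` (covariant velocity gauge) resp. `σ = ½ + a·HΩ(0)` (pinned gauge) is an exact
# eigenvalue of the linearised profile map at a strong zero, with eigenfunction `Ω′` (pointwise identity)

HONEST FRAMING (cell ns-blowup GROUP B / zone Z3, case Z3-SR-SPEC, EVEN half of the unstable-manifold census; 1-D MODEL —
the viscous gCLM / OSW sheet-ℝ profile equation; not Euler, not NS; «violates: none — MODEL»). Nothing here asserts that a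
profile exists; the file is calculus about ANY sufficiently regular strong zero. Companion of `SheetRTimeShiftMode` (the ODD
half: T-shift mode, `σ = 1`), whose spelling of the profile map and of the linearisation it follows verbatim:

  `G(Ω)(X) = Ω(X) + ½X·Ω′(X) + a·𝒰Ω(X)·Ω′(X) − HΩ(X)·Ω(X) − ν·Ω″(X)`,  `𝒰Ω(X) = ∫₀^X HΩ`,
  `DG(Ω)[v] = v + ½X·v′ + a·(𝒰v·Ω′ + 𝒰Ω·v′) − (Hv)·Ω − (HΩ)·v − ν·v″`.

For the TRANSLATION mode `v := Ω′` (an EVEN function when `Ω` is odd) the velocity of the perturbation is defined only up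
to an additive constant (the model fixes `u_x = Hω`, and a constant in `u` is a Galilean frame): writing the perturbation
velocity as `X ↦ HΩ(X) − c` (it equals `∫₀^X H[Ω′] + (HΩ(0) − c)` by `(HΩ)′ = H[Ω′]`,
`Summit.NavierStokesRegularity.OSWSelfSimilar.SheetRTranslationMode.velocity_translationMode`), differentiating the profile
equation once gives the exact identity, at a STRONG zero (`G(Ω) ≡ 0`) and at every `X`,

  **`DG_c(Ω)[Ω′](X) = −(½ + a·c)·Ω′(X)`**   (`Summit.NavierStokesRegularity.OSWSelfSimilar.SheetRTranslationMode.linearised_translationMode_eq`):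

* `c = 0` — the TRANSLATION-COVARIANT gauge (perturbation velocity `HΩ`, vanishing at `−∞` with `HΩ`; this is the
  linearisation of the log-kernel Biot–Savart velocity `u = π⁻¹ log|·| ∗ ω`, for which a shift of the blow-up point is a
  symmetry): `σ = ½` is an eigenvalue of `−DG(Ω)` with eigenfunction `Ω′`
  (`….linearised_translationMode_covariant`);
* `c = HΩ(0)` — the PINNED gauge `𝒰v(0) = 0` of the certificate's odd-class spelling, transported verbatim to even `v`:
  `σ = ½ + a·HΩ(0)` (`….linearised_translationMode_pinned`; at the certified sheet-ℝ point `a = 1/5`, `HΩ*(0) ≈ 3.9487`,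
  this is `≈ 1.2897` — a non-covariant artefact, the "falsifier" number of the cell's design probe kit j269261, which printed
  both `0.50000` and `1.28974`).

The analytic inputs are the tree's `Literature.Analysis.Fourier.hasDerivAt_hilbertTransform` (`(HΩ)′ = H[Ω′]`, through
`SheetRTimeShiftMode.hasDerivAt_hilbertTransform_profile`), valid in the
decay class `Ω ∈ C³`, `Ω ∈ L¹`, `|Ω″| ≤ M`, `|Ω′(ξ)| ≤ C/(1+ξ²)` (as in `SheetRTimeShiftMode`), and the fundamental theorem of
calculus. The algebra is the one-line skeleton `….skeleton` on point values.

WHAT THIS IS NOT: not the statement that `Ω*′` lies in the even energy class `E⁺₀` of a spectral certificate (`Ω*″ ∈ L²_{64+ξ²}`,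
zero mass — a weighted-decay statement about the certified zero), nor that the certified weak zero is `C³`; MODEL statement;
no NS content; no number of any certificate moves.
-/

noncomputable section

namespace Summit.NavierStokesRegularity.OSWSelfSimilar
namespace SheetRTranslationMode

open _root_.MeasureTheory _root_.Set _root_.Filter Literature.Analysis.Fourier intervalIntegral
open scoped Real Topology

/-! ### §1 The algebraic skeleton (explicit point values; no analysis) -/

/-- **Skeleton.** Write `Ω₀, Ω₁, Ω₂, Ω₃` for `Ω, Ω′, Ω″, Ω‴` at `X`, `h₀, h₁` for `HΩ, (HΩ)′ = H[Ω′]` at `X`, `U` for `𝒰Ω(X)`,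
and let `c` be the gauge constant. If the `X`-derivative of the profile equation holds at `X` (`hE'`, written with `𝒰Ω′ = HΩ`),
then the linearisation applied to the translation mode `v = Ω′` — values `v = Ω₁`, `v′ = Ω₂`, `v″ = Ω₃`, `Hv = h₁`, perturbation
velocity `h₀ − c` — equals `−(½ + a·c)·Ω₁`. [folklore] -/
theorem skeleton {a ν c X Ω₀ Ω₁ Ω₂ Ω₃ h₀ h₁ U : ℝ}
    (hE' : Ω₁ + (1 / 2 * Ω₁ + 1 / 2 * X * Ω₂) + a * (h₀ * Ω₁ + U * Ω₂) - (h₁ * Ω₀ + h₀ * Ω₁) - ν * Ω₃ = 0) :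
    Ω₁ + 1 / 2 * X * Ω₂ + a * ((h₀ - c) * Ω₁ + U * Ω₂) - h₁ * Ω₀ - h₀ * Ω₁ - ν * Ω₃
      = -(1 / 2 + a * c) * Ω₁ := by
  linear_combination hE'

/-! ### §2 Calculus of the mode `v = Ω′` -/

section calculus

variable {Ω : ℝ → ℝ}

/-- `C³` bookkeeping: the three `HasDerivAt` facts for `Ω, Ω′, Ω″`. [folklore] -/
private lemma contDiff_derivs (hΩ : ContDiff ℝ 3 Ω) :
    ContDiff ℝ 2 (deriv Ω) ∧
      (∀ x, HasDerivAt Ω (deriv Ω x) x) ∧ (∀ x, HasDerivAt (deriv Ω) (deriv (deriv Ω) x) x) ∧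
      (∀ x, HasDerivAt (deriv (deriv Ω)) (deriv (deriv (deriv Ω)) x) x) := by
  have h1 : ContDiff ℝ 2 (deriv Ω) := (contDiff_succ_iff_deriv.1 (hΩ : ContDiff ℝ (2 + 1) Ω)).2.2
  have h2 : ContDiff ℝ 1 (deriv (deriv Ω)) := (contDiff_succ_iff_deriv.1 (h1 : ContDiff ℝ (1 + 1) (deriv Ω))).2.2
  refine ⟨h1, fun x => ?_, fun x => ?_, fun x => ?_⟩
  · exact ((hΩ.differentiable (by norm_num)) x).hasDerivAt
  · exact ((h1.differentiable (by norm_num)) x).hasDerivAt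
  · exact ((h2.differentiable (by norm_num)) x).hasDerivAt

/-- `iteratedDeriv 2 f = deriv (deriv f)`. [folklore] -/
private lemma iteratedDeriv_two_eq (f : ℝ → ℝ) : iteratedDeriv 2 f = deriv (deriv f) := by
  rw [show (2 : ℕ) = 1 + 1 from rfl, iteratedDeriv_succ, iteratedDeriv_one]

/-- Under `|Ω′(ξ)| ≤ C/(1+ξ²)` the derivative is integrable. [folklore] -/
private lemma integrable_deriv (hΩ : ContDiff ℝ 3 Ω) {C : ℝ} (hC : ∀ y, |deriv Ω y| ≤ C / (1 + y ^ 2)) :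
    Integrable (deriv Ω) := by
  obtain ⟨h1, -, -, -⟩ := contDiff_derivs hΩ
  refine Integrable.mono' ((integrable_inv_one_add_sq).const_mul C) h1.continuous.aestronglyMeasurable
    (Eventually.of_forall fun y => ?_)
  rw [Real.norm_eq_abs]
  simpa [div_eq_mul_inv] using hC y

/-- `H[Ω′]` is continuous in the decay class (`Ω′ ∈ C¹ ∩ L¹`). [folklore] -/
private lemma continuous_hilbertTransform_deriv (hΩ : ContDiff ℝ 3 Ω) {C : ℝ}
    (hC : ∀ y, |deriv Ω y| ≤ C / (1 + y ^ 2)) : Continuous (hilbertTransform (deriv Ω)) := by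
  obtain ⟨h1, -, -, -⟩ := contDiff_derivs hΩ
  exact SheetRWeakProfilePV.continuous_hilbertTransform_of_contDiff (h1.of_le (by norm_num))
    (integrable_deriv hΩ hC)

/-- **Pinned velocity of the translation mode**: `𝒰[Ω′](X) = ∫₀^X H[Ω′] = HΩ(X) − HΩ(0)` (fundamental theorem of calculus
with `(HΩ)′ = H[Ω′]`). [folklore] -/
theorem velocity_translationMode (hΩ : ContDiff ℝ 3 Ω) (hΩi : Integrable Ω) {M C : ℝ}
    (hM : ∀ y, |deriv (deriv Ω) y| ≤ M) (hC : ∀ y, |deriv Ω y| ≤ C / (1 + y ^ 2)) (X : ℝ) :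
    ∫ s in (0 : ℝ)..X, hilbertTransform (deriv Ω) s = hilbertTransform Ω X - hilbertTransform Ω 0 := by
  have hH := SheetRTimeShiftMode.hasDerivAt_hilbertTransform_profile hΩ hΩi hM hC
  have hcH' : Continuous (hilbertTransform (deriv Ω)) := continuous_hilbertTransform_deriv hΩ hC
  exact intervalIntegral.integral_eq_sub_of_hasDerivAt (fun s _ => hH s) (hcH'.intervalIntegrable _ _)

end calculus

/-! ### §3 The translation identity at a strong zero -/

/-- **Translation mode, general gauge.** Let `Ω ∈ C³` lie in the decay class `Ω ∈ L¹`, `|Ω″| ≤ M`, `|Ω′(ξ)| ≤ C/(1+ξ²)`, and let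
it be a STRONG zero of the sheet-ℝ profile map, `Ω(X) + ½XΩ′(X) + a·(∫₀^X HΩ)·Ω′(X) − HΩ(X)·Ω(X) − ν·Ω″(X) = 0` for every `X`.
Then the translation mode `v = Ω′`, with perturbation velocity `X ↦ HΩ(X) − c` (`c` any constant), satisfies at every `X`
`v(X) + ½X·v′(X) + a·((HΩ(X) − c)·Ω′(X) + 𝒰Ω(X)·v′(X)) − Hv(X)·Ω(X) − HΩ(X)·v(X) − ν·v″(X) = −(½ + a·c)·v(X)`
(`Hv = H[Ω′]`, `v″ = iteratedDeriv 2 v`). MODEL statement, not NS. [folklore] -/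
theorem linearised_translationMode_eq {a ν c : ℝ} {Ω v : ℝ → ℝ} (hΩ : ContDiff ℝ 3 Ω) (hΩi : Integrable Ω)
    {M C : ℝ} (hM : ∀ y, |deriv (deriv Ω) y| ≤ M) (hC : ∀ y, |deriv Ω y| ≤ C / (1 + y ^ 2))
    (hG : ∀ X, Ω X + 1 / 2 * X * deriv Ω X + a * (∫ s in (0 : ℝ)..X, hilbertTransform Ω s) * deriv Ω X
      - hilbertTransform Ω X * Ω X - ν * iteratedDeriv 2 Ω X = 0)
    (hv : v = deriv Ω) (X : ℝ) :
    v X + 1 / 2 * X * deriv v X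
      + a * ((hilbertTransform Ω X - c) * deriv Ω X
        + (∫ s in (0 : ℝ)..X, hilbertTransform Ω s) * deriv v X)
      - hilbertTransform v X * Ω X - hilbertTransform Ω X * v X - ν * iteratedDeriv 2 v X
      = -(1 / 2 + a * c) * v X := by
  obtain ⟨-, hd1, hd2, hd3⟩ := contDiff_derivs hΩ
  subst hv
  have hH := SheetRTimeShiftMode.hasDerivAt_hilbertTransform_profile hΩ hΩi hM hC
  have hcH : Continuous (hilbertTransform Ω) := continuous_iff_continuousAt.2 fun x => (hH x).continuousAt
  -- `𝒰Ω′ = HΩ`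
  have hUd : ∀ X, HasDerivAt (fun Y => ∫ s in (0 : ℝ)..Y, hilbertTransform Ω s) (hilbertTransform Ω X) X :=
    fun X => (hcH.integral_hasStrictDerivAt 0 X).hasDerivAt
  -- the profile equation with `Ω″ = deriv (deriv Ω)`, as an identically vanishing function
  have hG' : ∀ X, Ω X + 1 / 2 * X * deriv Ω X + a * (∫ s in (0 : ℝ)..X, hilbertTransform Ω s) * deriv Ω X
      - hilbertTransform Ω X * Ω X - ν * deriv (deriv Ω) X = 0 := fun X => by
    have := hG X; rwa [iteratedDeriv_two_eq] at this
  -- its derivative at `X`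
  have hlin : HasDerivAt (fun ξ : ℝ => 1 / 2 * ξ) (1 / 2) X := by
    simpa using (hasDerivAt_id X).const_mul (1 / 2 : ℝ)
  have h := ((((hd1 X).add (hlin.mul (hd2 X))).add (((hUd X).mul (hd2 X)).const_mul a)).sub
    ((hH X).mul (hd1 X))).sub ((hd3 X).const_mul ν)
  have hfun : (Ω + (fun ξ : ℝ => 1 / 2 * ξ) * deriv Ω
        + (fun y => a * ((fun Y => ∫ s in (0 : ℝ)..Y, hilbertTransform Ω s) * deriv Ω) y)
        - hilbertTransform Ω * Ω - fun y => ν * deriv (deriv Ω) y) = fun _ => (0 : ℝ) := by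
    funext Y
    simp only [Pi.add_apply, Pi.mul_apply, Pi.sub_apply]
    linear_combination hG' Y
  rw [hfun] at h
  have hE' := h.unique (hasDerivAt_const X (0 : ℝ))
  -- `v″ = Ω‴`, `Hv = H[Ω′] = (HΩ)′`, then the skeleton
  rw [iteratedDeriv_two_eq]
  exact skeleton (Ω₀ := Ω X) (h₁ := hilbertTransform (deriv Ω) X) (U := ∫ s in (0 : ℝ)..X, hilbertTransform Ω s)
    (by linear_combination hE')

/-- **Covariant gauge: `σ = ½`.** Under the hypotheses of `linearised_translationMode_eq`, with the translation-covariant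
perturbation velocity `X ↦ HΩ(X)` (`c = 0`): `DG(Ω)[Ω′](X) = −½·Ω′(X)` at every `X`, i.e. `σ = ½` is an eigenvalue of `−DG(Ω)`
with eigenfunction the translation mode. MODEL statement, not NS. [folklore] -/
theorem linearised_translationMode_covariant {a ν : ℝ} {Ω v : ℝ → ℝ} (hΩ : ContDiff ℝ 3 Ω) (hΩi : Integrable Ω)
    {M C : ℝ} (hM : ∀ y, |deriv (deriv Ω) y| ≤ M) (hC : ∀ y, |deriv Ω y| ≤ C / (1 + y ^ 2))
    (hG : ∀ X, Ω X + 1 / 2 * X * deriv Ω X + a * (∫ s in (0 : ℝ)..X, hilbertTransform Ω s) * deriv Ω X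
      - hilbertTransform Ω X * Ω X - ν * iteratedDeriv 2 Ω X = 0)
    (hv : v = deriv Ω) (X : ℝ) :
    v X + 1 / 2 * X * deriv v X
      + a * (hilbertTransform Ω X * deriv Ω X
        + (∫ s in (0 : ℝ)..X, hilbertTransform Ω s) * deriv v X)
      - hilbertTransform v X * Ω X - hilbertTransform Ω X * v X - ν * iteratedDeriv 2 v X
      = -(1 / 2) * v X := by
  have h := linearised_translationMode_eq (c := 0) hΩ hΩi hM hC hG hv X
  simp only [sub_zero, mul_zero, add_zero] at h
  exact h

/-- **Pinned gauge: `σ = ½ + a·HΩ(0)`.** Under the same hypotheses, with the pinned perturbation velocity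
`𝒰v(X) = ∫₀^X H[v] = HΩ(X) − HΩ(0)` (the certificate's odd-class spelling `𝒰f = ∫₀^X Hf` applied verbatim to the even mode):
`v + ½X·v′ + a·(𝒰v·Ω′ + 𝒰Ω·v′) − Hv·Ω − HΩ·v − ν·v″ = −(½ + a·HΩ(0))·v` pointwise. MODEL statement, not NS. [folklore] -/
theorem linearised_translationMode_pinned {a ν : ℝ} {Ω v : ℝ → ℝ} (hΩ : ContDiff ℝ 3 Ω) (hΩi : Integrable Ω)
    {M C : ℝ} (hM : ∀ y, |deriv (deriv Ω) y| ≤ M) (hC : ∀ y, |deriv Ω y| ≤ C / (1 + y ^ 2))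
    (hG : ∀ X, Ω X + 1 / 2 * X * deriv Ω X + a * (∫ s in (0 : ℝ)..X, hilbertTransform Ω s) * deriv Ω X
      - hilbertTransform Ω X * Ω X - ν * iteratedDeriv 2 Ω X = 0)
    (hv : v = deriv Ω) (X : ℝ) :
    v X + 1 / 2 * X * deriv v X
      + a * ((∫ s in (0 : ℝ)..X, hilbertTransform v s) * deriv Ω X
        + (∫ s in (0 : ℝ)..X, hilbertTransform Ω s) * deriv v X)
      - hilbertTransform v X * Ω X - hilbertTransform Ω X * v X - ν * iteratedDeriv 2 v X
      = -(1 / 2 + a * hilbertTransform Ω 0) * v X := by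
  have h := linearised_translationMode_eq (c := hilbertTransform Ω 0) hΩ hΩi hM hC hG hv X
  have hU : ∫ s in (0 : ℝ)..X, hilbertTransform v s = hilbertTransform Ω X - hilbertTransform Ω 0 := by
    rw [hv]; exact velocity_translationMode hΩ hΩi hM hC X
  rw [hU]
  exact h

end SheetRTranslationMode
end Summit.NavierStokesRegularity.OSWSelfSimilar

end
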